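import Summits.KontsevichZagierPeriods.KontsevichZagierPeriods.Theses.SymplecticScissors
import Literature.NumberTheory.Transcendental.AyoubPeriodSeries
import Literature.NumberTheory.Transcendental.AyoubPeriodSeriesKernel
import Literature.NumberTheory.Transcendental.AyoubPeriodSeriesPiAlgebraic
import Literature.NumberTheory.Transcendental.AyoubPeriodSeriesVariables
import Summits.KontsevichZagierPeriods.KontsevichZagierPeriods.Theorems.UnfoldedStokesStokesGenerationStubSpanToRepsAuxCoeff
import Mathlib.RingTheory.MvPowerSeries.Rename
import Mathlib.RingTheory.MvPowerSeries.Substitution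
import Mathlib.RingTheory.MvPowerSeries.NoZeroDivisors
import Mathlib.RingTheory.Algebraic.Integral
import Mathlib.Algebra.MvPolynomial.PDeriv
import Summits.KontsevichZagierPeriods.KontsevichZagierPeriods.Theorems.SymplecticScissorsTypeAGenerationStubRoomLemmaIter

/-!
# `TypeAGeneration` (stmt-KontsevichZagierPeriods-18392), line `Sketch`: stub `stub_pdzMemOan` (W2)

Crux `Summit.KontsevichZagierPeriods.KontsevichZagierPeriods.Theses.SymplecticScissors.TypeAGeneration`
(Ayoub 2015 Conj. 1.1 = Fresán 2024 Conj. 3.5), line `Sketch` (card stokes-compiler), cycle 2: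
the (C2) interpolation certificate. **Stub W2**: Ayoub's algebra
`𝒪_{k-alg}(𝔻̄^∞) = AyoubRel.Oan σ` is stable under `∂/∂zᵢ = AyoubRel.pdz i`, GIVEN the derivation
rules of `pdz` (the statement of stub W1, carried as a hypothesis), together with the variables
(`∂ᵢ` introduces no variable) and the anisotropic weights (weights `ρ ≥ 1` summable for `F` stay
summable for `∂ᵢ F` after lowering the `i`-th weight to any `0 ≤ t < ρᵢ`).

Proof (all `[folklore]`; no definition is introduced), on top of the landed files
`SymplecticScissorsTypeAGenerationStub{SubstRoom,SubstRoomAux,RestrCOneAux,RoomLemmaIter}.lean`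
(weight algebra `s3_wprod_*`, `s4_prod_const_pow`, `s6_ws_mono`, `s3_polyToCSeries_X/_C`):

* `w2_usesVar_pdz`: `(∂ᵢ F)_a = (aᵢ + 1) F_{a + eᵢ}`;
* `w2_summable_weights`: `‖(∂ᵢF)_a‖ ρ[i ↦ t]^a = (aᵢ+1) tᵃⁱ ‖F_{a+eᵢ}‖ ρ^{a ∖ i} ≤ M ‖F_{a+eᵢ}‖ ρ^{a+eᵢ}`
  with `(n + 1) tⁿ ≤ M ρᵢⁿ⁺¹` (`(n+1) qⁿ ≤ Σ_{m ≤ n} q^m ≤ (1 − q)⁻¹`, `q = t/ρᵢ < 1`), and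
  `a ↦ a + eᵢ` is injective; `w2_hasPolyradiusGtOne`: constant weights `r`, `t = (1 + r)/2`;
* algebraicity (`w2_isAlg_map`), for any map `D` of `ℂ[[z]]` that is additive, Leibniz, kills
  constants and has `D z_l = [l = i]`: `D ∘ polyToCSeries σ = polyToCSeries σ ∘ ∂/∂z_i` on `k[z]`
  (`w2_map_polyToCSeries`), `D (G^n) = n G^{n-1} D G` (`w2_map_pow`), hence the chain rule
  `D (P(F)) = P^D(F) + P'(F) · D F` with `P^D(F)` algebraic (`P^D` = `∂ᵢ` applied to the
  coefficients); for `P ≠ 0` annihilating `F` of minimal degree, `P'(F) ≠ 0` (`char k = 0`,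
  `polyToCSeries σ` injective), so `P'(F) · D F = −P^D(F)` is algebraic with `P'(F)` an algebraic
  non-zero-divisor of the domain `ℂ[[z]]`, whence `D F` is algebraic (`IsAlgebraic.of_mul`).
-/

noncomputable section

-- `Summit.KontsevichZagierPeriods.KontsevichZagierPeriods.…` is the tree's mandated layout (single-conjunct summit).
set_option linter.dupNamespace false

namespace Summit.KontsevichZagierPeriods.KontsevichZagierPeriods.TypeAGenerationLine

open Finsupp MvPowerSeries
open Literature.NumberTheory.Transcendental
open Literature.NumberTheory.Transcendental.AyoubRel
open Summit.KontsevichZagierPeriods.KontsevichZagierPeriods.Theses.SymplecticScissors (TypeAGeneration)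

/-! ## Variables of `∂ᵢ F` -/

/-- `∂ᵢ` introduces no variable: `(∂ᵢ F)_a = (aᵢ + 1) F_{a + eᵢ}`. [folklore] -/
theorem w2_usesVar_pdz {F : CSeries} {i l : ℕ} (h : UsesVar (pdz i F) l) : UsesVar F l := by
  obtain ⟨a, hal, ha⟩ := h
  rw [StokesGenerationLine.coeff_pdz] at ha
  refine ⟨a + single i 1, fun h0 => hal ?_, right_ne_zero_of_mul ha⟩
  rw [Finsupp.add_apply] at h0
  exact Nat.eq_zero_of_add_eq_zero_right h0

/-! ## Anisotropic weights of `∂ᵢ F` -/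

/-- `(n + 1) qⁿ ≤ (1 − q)⁻¹` for `0 ≤ q < 1` (`(n+1) qⁿ ≤ Σ_{m ≤ n} q^m ≤ Σ_m q^m`). [folklore] -/
theorem w2_succ_mul_pow_le {q : ℝ} (hq0 : 0 ≤ q) (hq1 : q < 1) (n : ℕ) :
    ((n : ℝ) + 1) * q ^ n ≤ (1 - q)⁻¹ := by
  have hgeom := summable_geometric_of_lt_one hq0 hq1
  calc ((n : ℝ) + 1) * q ^ n = ∑ _m ∈ Finset.range (n + 1), q ^ n := by
        rw [Finset.sum_const, Finset.card_range, nsmul_eq_mul, Nat.cast_add, Nat.cast_one]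
    _ ≤ ∑ m ∈ Finset.range (n + 1), q ^ m :=
        Finset.sum_le_sum fun m hm =>
          pow_le_pow_of_le_one hq0 hq1.le (Nat.lt_succ_iff.mp (Finset.mem_range.mp hm))
    _ ≤ ∑' m, q ^ m := hgeom.sum_le_tsum _ fun m _ => pow_nonneg hq0 m
    _ = (1 - q)⁻¹ := tsum_geometric_of_lt_one hq0 hq1

/-- The growth bound behind the weights of `∂ᵢ`: for `0 ≤ t < r` there is `M ≥ 0` with
`(n + 1) tⁿ ≤ M rⁿ⁺¹` for all `n`. [folklore] -/
theorem w2_weight_bound {t r : ℝ} (ht : 0 ≤ t) (htr : t < r) :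
    ∃ M : ℝ, 0 ≤ M ∧ ∀ n : ℕ, ((n : ℝ) + 1) * t ^ n ≤ M * r ^ (n + 1) := by
  have hr : 0 < r := ht.trans_lt htr
  have hq0 : 0 ≤ t / r := div_nonneg ht hr.le
  have hq1 : t / r < 1 := (div_lt_one hr).mpr htr
  refine ⟨(1 - t / r)⁻¹ * r⁻¹, mul_nonneg (inv_nonneg.mpr (sub_nonneg.mpr hq1.le))
    (inv_nonneg.mpr hr.le), fun n => ?_⟩
  have ht' : t = t / r * r := (div_mul_cancel₀ t hr.ne').symm
  calc ((n : ℝ) + 1) * t ^ n = ((n : ℝ) + 1) * (t / r) ^ n * r ^ n := by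
        conv_lhs => rw [ht']
        rw [mul_pow, mul_assoc]
    _ ≤ (1 - t / r)⁻¹ * r ^ n :=
        mul_le_mul_of_nonneg_right (w2_succ_mul_pow_le hq0 hq1 n) (pow_nonneg hr.le n)
    _ = (1 - t / r)⁻¹ * r⁻¹ * r ^ (n + 1) := by
        rw [pow_succ]
        field_simp

/-- **Anisotropic weights of `∂ᵢ F`**: if `Σ_a ‖F_a‖ ρ^a < ∞` with `ρ ≥ 0` and `0 ≤ t < ρᵢ`, then
`Σ_a ‖(∂ᵢ F)_a‖ ρ[i ↦ t]^a < ∞`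
(`‖(∂ᵢF)_a‖ ρ[i ↦ t]^a = (aᵢ + 1) tᵃⁱ ‖F_{a+eᵢ}‖ ρ^{a ∖ i} ≤ M ‖F_{a+eᵢ}‖ ρ^{a+eᵢ}`). [folklore] -/
theorem w2_summable_weights {F : CSeries} {ρ : ℕ → ℝ} (hρ : ∀ l, 0 ≤ ρ l)
    (hs : Summable fun a : ℕ →₀ ℕ => ‖coeff a F‖ * a.prod fun l n => ρ l ^ n)
    (i : ℕ) {t : ℝ} (ht : 0 ≤ t) (htρ : t < ρ i) :
    Summable fun a : ℕ →₀ ℕ =>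
      ‖coeff a (pdz i F)‖ * a.prod fun l n => (Function.update ρ i t) l ^ n := by
  classical
  obtain ⟨M, -, hM⟩ := w2_weight_bound ht htρ
  have hWnn : ∀ l, 0 ≤ Function.update ρ i t l := fun l => by
    rcases eq_or_ne l i with rfl | hli
    · rw [Function.update_self]; exact ht
    · rw [Function.update_of_ne hli]; exact hρ l
  have hinj : Function.Injective fun a : ℕ →₀ ℕ => a + single i 1 := add_left_injective _
  refine ((hs.mul_left M).comp_injective hinj).of_nonneg_of_le
    (fun a => mul_nonneg (norm_nonneg _) (s3_wprod_nonneg hWnn a)) fun a => ?_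
  have hn : ‖(a i : ℂ) + 1‖ = (a i : ℝ) + 1 := by
    rw [show (a i : ℂ) + 1 = ((a i + 1 : ℕ) : ℂ) by push_cast; ring, Complex.norm_natCast]
    push_cast
    ring
  have hsupp : ∀ l ∈ (a.erase i).support, Function.update ρ i t l = ρ l := fun l hl => by
    have hli : l ≠ i := fun h => by
      rw [h, Finsupp.mem_support_iff, erase_same] at hl
      exact hl rfl
    exact Function.update_of_ne hli _ _
  have hP : 0 ≤ (a.erase i).prod fun l n => ρ l ^ n := s3_wprod_nonneg hρ _
  rw [Function.comp_apply, StokesGenerationLine.coeff_pdz, norm_mul, hn,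
    s3_wprod_split (Function.update ρ i t) a i, s3_wprod_congr hsupp, Function.update_self,
    s3_wprod_add, s3_wprod_single, s3_wprod_split ρ a i, pow_one]
  calc ((a i : ℝ) + 1) * ‖coeff (a + single i 1) F‖ *
        (((a.erase i).prod fun l n => ρ l ^ n) * t ^ (a i))
      = ((a i : ℝ) + 1) * t ^ (a i) *
          (‖coeff (a + single i 1) F‖ * (a.erase i).prod fun l n => ρ l ^ n) := by ring
    _ ≤ M * ρ i ^ (a i + 1) *
          (‖coeff (a + single i 1) F‖ * (a.erase i).prod fun l n => ρ l ^ n) :=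
        mul_le_mul_of_nonneg_right (hM (a i)) (mul_nonneg (norm_nonneg _) hP)
    _ = M * (‖coeff (a + single i 1) F‖ *
          (((a.erase i).prod fun l n => ρ l ^ n) * ρ i ^ (a i) * ρ i)) := by
        rw [pow_succ]
        ring

/-- **Polyradius of `∂ᵢ F`**: from the isotropic radius `r > 1` of `F`, the constant weights `r`
lowered to `t = (1 + r)/2` at `i` are summable for `∂ᵢ F`, hence so is the isotropic radius
`t > 1`. [folklore] -/
theorem w2_hasPolyradiusGtOne {F : CSeries} (hF : HasPolyradiusGtOne F) (i : ℕ) :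
    HasPolyradiusGtOne (pdz i F) := by
  obtain ⟨r, hr1, hs⟩ := hF
  have ht1 : 1 < (1 + r) / 2 := by linarith
  have htr : (1 + r) / 2 < r := by linarith
  have ht0 : 0 ≤ (1 + r) / 2 := by linarith
  have hs' : Summable fun a : ℕ →₀ ℕ => ‖coeff a F‖ * a.prod fun _ n => r ^ n :=
    hs.congr fun a => by rw [s4_prod_const_pow]
  have hw := w2_summable_weights (ρ := fun _ => r) (fun _ => by linarith) hs' i ht0 htr
  have hle : ∀ l, (1 + r) / 2 ≤ Function.update (fun _ : ℕ => r) i ((1 + r) / 2) l := fun l => by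
    rcases eq_or_ne l i with rfl | hli
    · rw [Function.update_self]
    · rw [Function.update_of_ne hli]; exact htr.le
  have hw' := s6_ws_mono (ρ' := fun _ => (1 + r) / 2) (fun _ => ht0) hle hw
  exact ⟨(1 + r) / 2, ht1, hw'.congr fun a => by rw [s4_prod_const_pow]⟩

/-! ## Algebraicity of `D F` for a derivation-like map `D` -/

section Deriv

variable {D : CSeries → CSeries}

/-- Powers under a Leibniz map: `D (Gⁿ) = n Gⁿ⁻¹ D G`. [folklore] -/
theorem w2_map_pow (hmul : ∀ F G : CSeries, D (F * G) = D F * G + F * D G) (h1 : D 1 = 0)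
    (G : CSeries) (n : ℕ) : D (G ^ n) = (n : CSeries) * G ^ (n - 1) * D G := by
  induction n with
  | zero => rw [pow_zero, h1, Nat.cast_zero, zero_mul, zero_mul]
  | succ n ih =>
    rw [pow_succ, hmul, ih, Nat.add_sub_cancel, Nat.cast_succ]
    cases n with
    | zero => simp
    | succ m => rw [Nat.add_sub_cancel, pow_succ]; ring

variable {k : Type} [Field k] (σ : k →+* ℂ)

/-- A Leibniz, additive map of `ℂ[[z]]` killing constants with `D z_l = [l = i]` restricts to
`∂/∂zᵢ` on `k[z]`: `D (polyToCSeries σ q) = polyToCSeries σ (∂q/∂zᵢ)`. [folklore] -/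
theorem w2_map_polyToCSeries (hadd : ∀ F G : CSeries, D (F + G) = D F + D G)
    (hmul : ∀ F G : CSeries, D (F * G) = D F * G + F * D G) (i : ℕ)
    (hX : ∀ l : ℕ, D (X l) = if l = i then 1 else 0) (hC : ∀ c : ℂ, D (C c) = 0)
    (q : MvPolynomial ℕ k) :
    D (polyToCSeries σ q) = polyToCSeries σ (MvPolynomial.pderiv i q) := by
  induction q using MvPolynomial.induction_on with
  | C a => rw [s3_polyToCSeries_C, hC, MvPolynomial.pderiv_C, map_zero]
  | add p q hp hq =>
    rw [map_add (polyToCSeries σ) p q, hadd, hp, hq, map_add (MvPolynomial.pderiv i) p q,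
      map_add (polyToCSeries σ)]
  | mul_X p n hp =>
    rw [map_mul (polyToCSeries σ) p, s3_polyToCSeries_X, hmul, hp, hX n,
      MvPolynomial.pderiv_mul, MvPolynomial.pderiv_X, map_add (polyToCSeries σ),
      map_mul (polyToCSeries σ), map_mul (polyToCSeries σ), s3_polyToCSeries_X]
    by_cases hn : n = i
    · rw [if_pos hn, hn, Pi.single_eq_same, map_one]
    · rw [if_neg hn, Pi.single_eq_of_ne hn, map_zero]

/-- `polyToCSeries σ a` is algebraic over `k(z)` (root of `Y − a`). [folklore] -/
theorem w2_isAlg_polyToCSeries (a : MvPolynomial ℕ k) :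
    IsAlgebraicOverRatFunc σ (polyToCSeries σ a) :=
  ⟨Polynomial.X - Polynomial.C a, Polynomial.X_sub_C_ne_zero a, by
    rw [Polynomial.eval₂_sub, Polynomial.eval₂_X, Polynomial.eval₂_C, sub_self]⟩

/-- Powers of algebraic elements are algebraic. [folklore] -/
theorem w2_isAlg_pow {F : CSeries} (hF : IsAlgebraicOverRatFunc σ F) (n : ℕ) :
    IsAlgebraicOverRatFunc σ (F ^ n) := by
  letI : Algebra (MvPolynomial ℕ k) CSeries := (polyToCSeries σ).toAlgebra
  exact ((isAlgebraicOverRatFunc_iff_isAlgebraic σ F).mp hF).pow n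

/-- Polynomial expressions `Q(F)`, `Q ∈ k[z][Y]`, in an algebraic `F` are algebraic. [folklore] -/
theorem w2_isAlg_eval₂ {F : CSeries} (hF : IsAlgebraicOverRatFunc σ F)
    (Q : Polynomial (MvPolynomial ℕ k)) :
    IsAlgebraicOverRatFunc σ (Q.eval₂ (polyToCSeries σ) F) := by
  induction Q using Polynomial.induction_on' with
  | add p q hp hq => rw [Polynomial.eval₂_add]; exact hp.add σ hq
  | monomial n a =>
    rw [Polynomial.eval₂_monomial]
    exact (w2_isAlg_polyToCSeries σ a).mul σ (w2_isAlg_pow σ hF n)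

/-- **Algebraic elements are stable under `∂/∂zᵢ`-like maps.** Let `D` be an additive Leibniz map
of `ℂ[[z]]` killing constants with `D z_l = [l = i]`, and `F` algebraic over `k(z)`
(`char k = 0`). Chain rule: `D (P(F)) = P^D(F) + P'(F) D F` with `P^D(F)` algebraic; for
`P ≠ 0` annihilating `F` of minimal degree, `P'(F) ≠ 0` (else `P' = 0` by minimality, so `P` is a
non-zero constant, not a relation since `polyToCSeries σ` is injective); so `P'(F) D F = −P^D(F)`
is algebraic, `P'(F)` is an algebraic non-zero-divisor of the domain `ℂ[[z]]`, and `D F` is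
algebraic. [folklore] -/
theorem w2_isAlg_map [CharZero k] (hadd : ∀ F G : CSeries, D (F + G) = D F + D G)
    (hmul : ∀ F G : CSeries, D (F * G) = D F * G + F * D G) (i : ℕ)
    (hX : ∀ l : ℕ, D (X l) = if l = i then 1 else 0) (hC : ∀ c : ℂ, D (C c) = 0)
    {F : CSeries} (hF : IsAlgebraicOverRatFunc σ F) : IsAlgebraicOverRatFunc σ (D F) := by
  classical
  have h1 : D 1 = 0 := by
    have h := hC 1
    rwa [map_one] at h
  have h0 : D 0 = 0 := by
    have h := hC 0
    rwa [map_zero] at h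
  -- the chain rule
  have hchain : ∀ Q : Polynomial (MvPolynomial ℕ k), ∃ w : CSeries, IsAlgebraicOverRatFunc σ w ∧
      D (Q.eval₂ (polyToCSeries σ) F) =
        w + (Polynomial.derivative Q).eval₂ (polyToCSeries σ) F * D F := by
    intro Q
    induction Q using Polynomial.induction_on' with
    | add p q hp hq =>
      obtain ⟨w₁, hw₁, h₁⟩ := hp
      obtain ⟨w₂, hw₂, h₂⟩ := hq
      refine ⟨w₁ + w₂, hw₁.add σ hw₂, ?_⟩
      rw [Polynomial.eval₂_add, hadd, h₁, h₂, Polynomial.derivative_add, Polynomial.eval₂_add]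
      ring
    | monomial n a =>
      refine ⟨polyToCSeries σ (MvPolynomial.pderiv i a) * F ^ n,
        (w2_isAlg_polyToCSeries σ _).mul σ (w2_isAlg_pow σ hF n), ?_⟩
      rw [Polynomial.eval₂_monomial, hmul, w2_map_polyToCSeries σ hadd hmul i hX hC,
        w2_map_pow hmul h1, Polynomial.derivative_monomial, Polynomial.eval₂_monomial, map_mul,
        map_natCast]
      ring
  -- a non-zero annihilating polynomial of minimal degree
  have hex : ∃ d : ℕ, ∃ P : Polynomial (MvPolynomial ℕ k), P ≠ 0 ∧
      P.eval₂ (polyToCSeries σ) F = 0 ∧ P.natDegree = d := by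
    obtain ⟨P, hP0, hP⟩ := hF
    exact ⟨_, P, hP0, hP, rfl⟩
  obtain ⟨P, hP0, hPF, hPd⟩ := Nat.find_spec hex
  have hmin : ∀ Q : Polynomial (MvPolynomial ℕ k), Q ≠ 0 → Q.eval₂ (polyToCSeries σ) F = 0 →
      P.natDegree ≤ Q.natDegree := fun Q hQ0 hQ => by
    rw [hPd]
    exact Nat.find_min' hex ⟨Q, hQ0, hQ, rfl⟩
  have hPdeg : P.natDegree ≠ 0 := by
    intro hd
    apply hP0
    have hc := Polynomial.eq_C_of_natDegree_eq_zero hd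
    rw [hc, Polynomial.eval₂_C] at hPF
    rw [hc, polyToCSeries_injective σ (hPF.trans (map_zero _).symm), map_zero]
  have hy0 : (Polynomial.derivative P).eval₂ (polyToCSeries σ) F ≠ 0 := fun h =>
    absurd (hmin _ (Polynomial.derivative_ne_zero.mpr hPdeg) h)
      (not_le.mpr (Polynomial.natDegree_derivative_lt hPdeg))
  obtain ⟨w, hw, hDP⟩ := hchain P
  rw [hPF, h0] at hDP
  have hyw : (Polynomial.derivative P).eval₂ (polyToCSeries σ) F * D F = -w :=
    eq_neg_of_add_eq_zero_right hDP.symm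
  letI : Algebra (MvPolynomial ℕ k) CSeries := (polyToCSeries σ).toAlgebra
  have hy : IsAlgebraic (MvPolynomial ℕ k)
      ((Polynomial.derivative P).eval₂ (polyToCSeries σ) F) :=
    (isAlgebraicOverRatFunc_iff_isAlgebraic σ _).mp (w2_isAlg_eval₂ σ hF _)
  have hyz : IsAlgebraic (MvPolynomial ℕ k)
      ((Polynomial.derivative P).eval₂ (polyToCSeries σ) F * D F) := by
    rw [hyw]
    exact (isAlgebraicOverRatFunc_iff_isAlgebraic σ _).mp (hw.neg σ)
  exact (isAlgebraicOverRatFunc_iff_isAlgebraic σ _).mpr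
    (IsAlgebraic.of_mul (mem_nonZeroDivisors_of_ne_zero hy0) hy hyz)

end Deriv

/-! ## The registered stub -/

/-- W2 — `𝒪_{k-alg}(𝔻̄^∞)` is stable under `∂/∂zᵢ` (given the derivation rules W1), with variables
and weights. [folklore] -/
theorem stub_pdzMemOan :
    (∀ (i : ℕ) (F G : CSeries) (c : ℂ),
      pdz i (c • F + G) = c • pdz i F + pdz i G ∧
      pdz i (F * G) = pdz i F * G + F * pdz i G ∧
      (∀ j : ℕ, pdz i (pdz j F) = pdz j (pdz i F)) ∧
      (∀ l : ℕ, pdz i (X l : CSeries) = if l = i then 1 else 0) ∧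
      pdz i (C c : CSeries) = 0) →
    ∀ (k : Type) [Field k] [CharZero k] (σ : k →+* ℂ) (F : CSeries), F ∈ Oan σ → ∀ (i : ℕ),
      pdz i F ∈ Oan σ ∧
      (∀ l : ℕ, UsesVar (pdz i F) l → UsesVar F l) ∧
      (∀ ρ : ℕ → ℝ, (∀ l, 1 ≤ ρ l) →
        Summable (fun a : ℕ →₀ ℕ => ‖MvPowerSeries.coeff a F‖ * a.prod fun l n => ρ l ^ n) →
        ∀ t : ℝ, 0 ≤ t → t < ρ i →
        Summable (fun a : ℕ →₀ ℕ =>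
          ‖MvPowerSeries.coeff a (pdz i F)‖ * a.prod fun l n => (Function.update ρ i t) l ^ n)) := by
  intro hW1 k _ _ σ F hF i
  have hadd : ∀ F G : CSeries, pdz i (F + G) = pdz i F + pdz i G := fun F G => by
    have h := (hW1 i F G 1).1
    rwa [one_smul, one_smul] at h
  have hmul : ∀ F G : CSeries, pdz i (F * G) = pdz i F * G + F * pdz i G := fun F G =>
    (hW1 i F G 0).2.1
  have hX : ∀ l : ℕ, pdz i (X l : CSeries) = if l = i then 1 else 0 := (hW1 i 0 0 0).2.2.2.1
  have hC : ∀ c : ℂ, pdz i (C c : CSeries) = 0 := fun c => (hW1 i 0 0 c).2.2.2.2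
  obtain ⟨⟨m, hm⟩, hrad, halg⟩ := hF
  exact ⟨⟨⟨m, StokesGenerationLine.dependsOnlyOnLT_pdz i hm⟩, w2_hasPolyradiusGtOne hrad i,
      w2_isAlg_map σ hadd hmul i hX hC halg⟩,
    fun l hl => w2_usesVar_pdz hl,
    fun ρ hρ hs t ht htρ => w2_summable_weights (fun l => zero_le_one.trans (hρ l)) hs i ht htρ⟩

end Summit.KontsevichZagierPeriods.KontsevichZagierPeriods.TypeAGenerationLine
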